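import Mathlib
import Summits.ValiantsHypothesis.ValiantsHypothesis.Theorems.NewtonTauWeak.Negative.Zonogon

/-!
# `NewtonTauWeak` (stmt-ValiantsHypothesis-5904), line `binomial-normal-form`: objects of the CARRY AUTOMATON
# for the digit hexagon (lead c4; K-UNIFORM regime)

Route-posited objects (D-0016 `…Defs` file) for the K-uniform analysis of the open stub
`stub_binomialNewtonTauCommon` (KPTT arXiv:1308.2286 Conj. 1 at `t = 2`) on the DIGIT HEXAGON frame
`{2^i·(1,0), 2^i·(0,1), 2^i·(1,1) : i < n}` (lead c2's "smallest honest open playground"; closed at every FIXED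
number of products by `hex_vert_sum_hexagon_le_allK`, p120894; open uniformly in the number `K` of products).

The product `G = Π_{i<n} (1 - a_i x^{2^i})(1 - b_i y^{2^i})(1 - g_i (xy)^{2^i})` (`hexProd`) has coefficient at
`(p, q)`, `p, q < 2^{n+1}`, equal to the `((0,0), (p_n, q_n))` entry of the ordered product of the `4 × 4` CARRY
TRANSFER MATRICES `hexT (a_i) (b_i) (g_i) p_i q_i` (`hexN`; states = pairs of carries `κ ∈ {0,1}²`, input = the digit
pair `(p_i, q_i)`; entry `κ → κ'` = `Σ` over `(a,b,c) ∈ {0,1}³` with `a + c + κ₁ = p_i + 2κ'₁`, `b + c + κ₂ = q_i + 2κ'₂`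
of `(-a_i)^a (-b_i)^b (-g_i)^c`) — checked numerically (kit/automaton_check.py, 24 random instances, 0 mismatches) and
proved in `…AutomatonCoeff.lean`.  Hence the coefficient ARRAY of a sum of `K` such products is a linear image of the
VECTOR CONFIGURATION `P ↦ hexVec … P ∈ ℂ^{K×4×4}` (`hexVecFin`, flattened to `Fin (K*16)`), and this configuration is
BILINEARLY SELF-SIMILAR under splitting the digits (`hexN` over levels `[0, h+m)` = product of the level-`[0,h)` and
level-`[h,h+m)` matrices; `kron`, `hexContract`).  With Theorem Q's greedy-shadow engine (`QuasiPoly.cshadow`,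
`configShadow_prod_le`, crux 5905) this gives a QUASI-POLYNOMIAL vertex bound UNIFORM IN `K` (`…AutomatonAssembly.lean`).
Everything here is a definition [folklore: carry automaton / transfer matrices of digit expansions].
-/

-- the namespace mandated for this Theorems file repeats the component `ValiantsHypothesis`
set_option linter.dupNamespace false

noncomputable section

open scoped BigOperators
open MvPolynomial

namespace Summit.ValiantsHypothesis.ValiantsHypothesis.Theorems.NewtonTauWeakAutomaton

/-! ## Carry states and transfer matrices -/

/-- Carry states of the automaton: a pair of carries `(κ₁, κ₂) ∈ {0,1}²` (one per coordinate). [folklore] -/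
abbrev St : Type := Fin 2 × Fin 2

/-- The carry transfer matrix of ONE level with parameters `(a, b, g)` (the level's three binomials
`1 - a x^{2^i}`, `1 - b y^{2^i}`, `1 - g (xy)^{2^i}`) reading the digit pair `(p, q)`: entry `κ → κ'` sums
`(-a)^u₁ (-b)^u₂ (-g)^u₃` over the bit triples `u ∈ {0,1}³` with `u₁ + u₃ + κ₁ = p + 2κ'₁` and
`u₂ + u₃ + κ₂ = q + 2κ'₂`. [folklore] -/
def hexT (a b g : ℂ) (p q : ℕ) : Matrix St St ℂ := fun κ κ' =>
  ∑ u : Fin 2 × Fin 2 × Fin 2,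
    if (u.1 : ℕ) + u.2.2 + κ.1 = p + 2 * κ'.1 ∧ (u.2.1 : ℕ) + u.2.2 + κ.2 = q + 2 * κ'.2 then
      (-a) ^ (u.1 : ℕ) * (-b) ^ (u.2.1 : ℕ) * (-g) ^ (u.2.2 : ℕ)
    else 0

/-- The ordered product of the transfer matrices of the levels `lo, lo+1, …, lo+len-1` (parameters `a, b, g : ℕ → ℂ`
indexed by level), reading the binary digits of the position `P = (p, q)` at those levels. [folklore] -/
def hexN (a b g : ℕ → ℂ) (lo len : ℕ) (P : ℕ × ℕ) : Matrix St St ℂ :=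
  ((List.range' lo len).map fun i => hexT (a i) (b i) (g i) (P.1.testBit i).toNat (P.2.testBit i).toNat).prod

/-! ## The vector configuration of `K` products -/

/-- Index type of the configuration vectors: (product, in-state, out-state). [folklore] -/
abbrev Idx (K : ℕ) : Type := Fin K × (St × St)

/-- `Idx K` has `K * 16` elements. -/
theorem card_Idx (K : ℕ) : Fintype.card (Idx K) = K * 16 := by
  simp [Idx, St, Fintype.card_prod, Fintype.card_fin]

/-- A fixed enumeration `Idx K ≃ Fin (K * 16)`. [folklore] -/
def idxEquiv (K : ℕ) : Idx K ≃ Fin (K * 16) :=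
  Fintype.equivFinOfCardEq (card_Idx K)

/-- The configuration vector at position `P` of `K` digit-hexagon products with level parameters
`a b g : Fin K → ℕ → ℂ`, over the levels `[lo, lo+len)`: all entries of all `K` transfer-matrix products. [folklore] -/
def hexVec (K : ℕ) (a b g : Fin K → ℕ → ℂ) (lo len : ℕ) (P : ℕ × ℕ) : Idx K → ℂ :=
  fun i => hexN (a i.1) (b i.1) (g i.1) lo len P i.2.1 i.2.2

/-- The same vector, flattened to `Fin (K * 16) → ℂ` (the shape used by Theorem Q's `QuasiPoly.cshadow`). [folklore] -/
def hexVecFin (K : ℕ) (a b g : Fin K → ℕ → ℂ) (lo len : ℕ) (P : ℕ × ℕ) : Fin (K * 16) → ℂ :=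
  fun j => hexVec K a b g lo len P ((idxEquiv K).symm j)

/-- Shifting the level parameters by `h` levels. [folklore] -/
def shiftPar {K : ℕ} (a : Fin K → ℕ → ℂ) (h : ℕ) : Fin K → ℕ → ℂ := fun l i => a l (i + h)

/-- The `i`-th binary digit of `p`, as an element of `Fin 2`. [folklore] -/
def bitF (p i : ℕ) : Fin 2 := ⟨(p.testBit i).toNat, Bool.toNat_lt _⟩

/-- The box of positions with `n` binary digits per coordinate. [folklore] -/
def box (n : ℕ) : Finset (ℕ × ℕ) := Finset.range (2 ^ n) ×ˢ Finset.range (2 ^ n)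

/-! ## Kronecker products and the contraction (the bilinear self-similarity) -/

/-- Kronecker product of two vectors, flattened along `finProdFinEquiv`. [folklore] -/
def kron {d₁ d₂ : ℕ} (u : Fin d₁ → ℂ) (v : Fin d₂ → ℂ) : Fin (d₁ * d₂) → ℂ :=
  fun j => u (finProdFinEquiv.symm j).1 * v (finProdFinEquiv.symm j).2

/-- The contraction `ℂ^{(K·16)·(K·16)} → ℂ^{K·16}` realising blockwise matrix multiplication
"low levels first, then high levels": on a Kronecker product `kron (high vector) (low vector)` it returns the
vector of the products `N_low · N_high` (entry `(l, κ, κ'') = Σ_{κ'} low(l, κ, κ') · high(l, κ', κ'')`). [folklore] -/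
def hexContract (K : ℕ) : (Fin (K * 16 * (K * 16)) → ℂ) →ₗ[ℂ] (Fin (K * 16) → ℂ) where
  toFun Z j :=
    let i := (idxEquiv K).symm j
    ∑ κ' : St, Z (finProdFinEquiv (idxEquiv K (i.1, (κ', i.2.2)), idxEquiv K (i.1, (i.2.1, κ'))))
  map_add' Z Z' := by
    funext j
    simp only [Pi.add_apply]
    rw [← Finset.sum_add_distrib]
  map_smul' c Z := by
    funext j
    simp only [Pi.smul_apply, smul_eq_mul, RingHom.id_apply]
    rw [Finset.mul_sum]

/-! ## The polynomials -/

/-- The level-`i` factor `(1 - a x^{2^i})(1 - b y^{2^i})(1 - g (xy)^{2^i})` of a digit-hexagon product. [folklore] -/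
def hexFactor (a b g : ℂ) (i : ℕ) : MvPolynomial (Fin 2) ℂ :=
  (1 - C a * monomial (Finsupp.single 0 (2 ^ i)) 1) *
    (1 - C b * monomial (Finsupp.single 1 (2 ^ i)) 1) *
      (1 - C g * monomial (Finsupp.single 0 (2 ^ i) + Finsupp.single 1 (2 ^ i)) 1)

/-- A digit-hexagon product with `n` levels and level parameters `a b g : ℕ → ℂ`. [folklore] -/
def hexProd (a b g : ℕ → ℂ) (n : ℕ) : MvPolynomial (Fin 2) ℂ :=
  ∏ i ∈ Finset.range n, hexFactor (a i) (b i) (g i) i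

/-- A sum of `K` scalar multiples of digit-hexagon products on the common `n`-level digit hexagon frame
(an instance of `BinomialBoundCommon` with `N = 3n`; `ρ = 0` entries allowed). [folklore] -/
def hexSum (K n : ℕ) (c : Fin K → ℂ) (a b g : Fin K → ℕ → ℂ) : MvPolynomial (Fin 2) ℂ :=
  ∑ l, C (c l) * hexProd (a l) (b l) (g l) n

end Summit.ValiantsHypothesis.ValiantsHypothesis.Theorems.NewtonTauWeakAutomaton

end
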